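/-
Origin: expansion seat `prover-pub-hodgecm-mc-binder-2-g11-0`, handover #47 2026-08-20T03:59Z md5 d7dc419a0006 (130 l.; CERTIFIED rc 0 / 0 warn / 37.9 s; imports #46; the Σ₁₂ NEGATIVE-reading twin of #15: `linSubst_star_dualPairι_kV_rename_P_neg` / `_P_pow_neg` (`P = Σ z_a w_a` under `mixedToDPIdxNeg` fixed by every `K_V`-letter `((A,D),(1,1))`, unitarity `D D⋆ = 1`, rows QS/QR of #44) and the datum-level **`linSubst_kV_placePoly_of_eq_sigmaNeg`**; with #43/#46 EVERY per-place `hd` input of #42 for the K_V-letters now exists for all four datum constructors (sigmaPos, sigmaNeg, delta, iota R/S); NAME LIST `HodgeCM.Model.HypCensus.linSubst_kV_placePoly_of_eq_sigmaNeg`, `HodgeCM.Model.HypCensus.linSubst_star_dualPairι_kV_rename_P_pow_neg`; axioms: no new) (`HOME/mc/pub-hodgecm-mc-binder-2/g11/pkg/HodgeCM/Model/HypCensus/VLetterSigmaNeg.lean`, md5 d7dc419a0006, 130 lines);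
landed by the second packager p2 gen 2 (p2-g2) in gate run 40 as `HodgeCM/Model/HypCensus/VLetterSigmaNeg.lean` (verbatim).
-/
/-
Origin: speedrun cell pub-hodgecm, MODEL-CONSTRUCTION sub-cell, lineage mc-binder-2 (BINDER-OWNERS rows 18/19: E binders
`hyp12` / `hyp34` of `Model.perL_picardCM_r15A`), seat prover-pub-hodgecm-mc-binder-2-g11-0 (gen 11), 2026-08-20.
Target in PKG: `HodgeCM/Model/HypCensus/VLetterSigmaNeg.lean` (NEW additive leaf; imports this lineage's `HypCensus/VLetterSigma` (#46)).
KERNEL ONLY: 0 records, nothing cited as hypothesis, 0 `def … : Prop`; theorems only.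
-/
import Summits.HodgeConjecture.HodgeCM.Model.HypCensus.VLetterSigma

/-!
# Census kit (rows A12/A34), (J-x₀) step (d): the Σ₁₂ place with `V` read NEGATIVE

The #15-twin for the negative reading (`mixedToDPIdxNeg`: `z_a ↦ (eA a, s₀) ∈ Q × S`, `w_a ↦ (eA a, r₀) ∈ Q × R`): the pairing
`P = Σ_a z_a w_a` — hence every `P^k`, hence EVERY printed vector (#45) — is FIXED by every `K_V`-letter `((A, D), (1, 1))`
(unitarity `D D⋆ = 1`; rows `_X_QS_general` / `_X_QR_general` of #44), and the datum-level wrapper for `sigmaNeg`.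

* `linSubst_star_dualPairι_kV_rename_P_neg`, `…_P_pow_neg`, **`linSubst_kV_placePoly_of_eq_sigmaNeg`**.
-/

set_option autoImplicit false

noncomputable section

open NumberField NumberField.InfinitePlace
open scoped Classical
open MvPolynomial
open Literature.NumberTheory.Automorphic Literature.NumberTheory.Automorphic.UnitaryGroup Literature.NumberTheory.Weil1964
open Literature.RepresentationTheory.KonnoKonno2007 Literature.RepresentationTheory.KonnoKonno2007.RealDualPair
open Literature.NumberTheory.GelbartRogawski1991 Literature.NumberTheory.GelbartRogawski1991.UnitaryDualPair
open Literature.Analysis.SegalBargmann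
open HodgeCM.PerL34.Fock HodgeCM.PerL34.Fock.PrintDict

namespace HodgeCM.Model.HypCensus

section Poly

variable {Q' R' S' : Type} [Fintype Q'] [DecidableEq Q'] [Fintype R'] [DecidableEq R'] [Fintype S'] [DecidableEq S']
variable (P' : Type) [Fintype P'] [DecidableEq P'] (eA : Fin 3 ≃ Q') (r₀ : R') (s₀ : S')

/-- **`Σ_q z_q w_q` (negative reading) is invariant under `K_V`.** [folklore; the unitarity `b b⋆ = 1`] -/
theorem linSubst_star_dualPairι_kV_rename_P_neg (kV : Matrix.unitaryGroup P' ℂ × Matrix.unitaryGroup Q' ℂ) :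
    linSubst (star ((dualPairι ((kV, (1, 1)) : DPK P' Q' R' S') : Matrix.unitaryGroup (DPIdx P' Q' R' S') ℂ) :
        Matrix (DPIdx P' Q' R' S') (DPIdx P' Q' R' S') ℂ)) (rename (mixedToDPIdxNeg P' eA r₀ s₀) HodgeCM.PerL34.Fock.P) =
      rename (mixedToDPIdxNeg P' eA r₀ s₀) HodgeCM.PerL34.Fock.P := by
  have hbb : ∀ q' q'' : Q', ∑ q, ((kV.2 : Matrix.unitaryGroup Q' ℂ) : Matrix Q' Q' ℂ) q' q *
      star (((kV.2 : Matrix.unitaryGroup Q' ℂ) : Matrix Q' Q' ℂ) q'' q) = if q' = q'' then 1 else 0 := by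
    intro q' q''
    have h1 := Matrix.mem_unitaryGroup_iff.mp kV.2.2
    have h2 := congrFun (congrFun h1 q') q''
    simpa only [Matrix.mul_apply, Matrix.star_apply, Matrix.one_apply] using h2
  rw [rename_mixedToDPIdxNeg_P, map_sum]
  simp only [map_mul, linSubst_star_dualPairι_X_QS_general, linSubst_star_dualPairι_X_QR_general, OneMemClass.coe_one,
    Matrix.one_apply, mul_ite, mul_one, mul_zero, apply_ite star, star_one, star_zero, apply_ite C, map_zero, ite_mul, zero_mul,
    Finset.sum_ite_eq', Finset.mem_univ, if_true, Finset.sum_mul, Finset.mul_sum]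
  rw [Finset.sum_comm]
  refine Finset.sum_congr rfl fun q' _ => ?_
  rw [Finset.sum_comm]
  have e : ∀ y : Q', ∑ x : Q', C (((kV.2 : Matrix.unitaryGroup Q' ℂ) : Matrix Q' Q' ℂ) y x) *
        X (Sum.inl (Sum.inr (y, s₀)) : DPIdx P' Q' R' S') *
      (C (star (((kV.2 : Matrix.unitaryGroup Q' ℂ) : Matrix Q' Q' ℂ) q' x)) * X (Sum.inr (Sum.inr (q', r₀)))) =
      (X (Sum.inl (Sum.inr (y, s₀))) * X (Sum.inr (Sum.inr (q', r₀)))) *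
        C (∑ x, ((kV.2 : Matrix.unitaryGroup Q' ℂ) : Matrix Q' Q' ℂ) y x *
          star (((kV.2 : Matrix.unitaryGroup Q' ℂ) : Matrix Q' Q' ℂ) q' x)) := fun y => by
    rw [map_sum, Finset.mul_sum]
    refine Finset.sum_congr rfl fun x _ => ?_
    rw [map_mul]
    ring
  simp only [e, hbb, apply_ite C, map_one, map_zero, mul_ite, mul_one, mul_zero, Finset.sum_ite_eq', Finset.mem_univ, if_true]

/-- … hence every `P^k` (negative reading) is fixed. -/
theorem linSubst_star_dualPairι_kV_rename_P_pow_neg (kV : Matrix.unitaryGroup P' ℂ × Matrix.unitaryGroup Q' ℂ) (k : ℕ) :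
    linSubst (star ((dualPairι ((kV, (1, 1)) : DPK P' Q' R' S') : Matrix.unitaryGroup (DPIdx P' Q' R' S') ℂ) :
        Matrix (DPIdx P' Q' R' S') (DPIdx P' Q' R' S') ℂ)) (rename (mixedToDPIdxNeg P' eA r₀ s₀) (HodgeCM.PerL34.Fock.P ^ k)) =
      rename (mixedToDPIdxNeg P' eA r₀ s₀) (HodgeCM.PerL34.Fock.P ^ k) := by
  rw [map_pow, map_pow, linSubst_star_dualPairι_kV_rename_P_neg]

end Poly

section Datum

variable (L : Type) [Field L] [NumberField L] [IsCMField L]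
variable (dV : Fin 3 → L) (hdV : ∀ i, IsCMField.complexConj L (dV i) = dV i)
variable (dW : Fin 2 → L) (hdW : ∀ i, IsCMField.complexConj L (dW i) = dW i) (ι₁ : L →+* ℂ)
variable (datum : ∀ b : InfinitePlace L, PlaceDatum L dV hdV dW hdW ι₁ (cmPlacesEquiv L b)) (m₁ m₂ : InfinitePlace L → ℤ)

/-- **Σ₁₂ place read negative: every place polynomial is FIXED by every `K_V`-letter `((A,D),(1,1))`.** -/
theorem linSubst_kV_placePoly_of_eq_sigmaNeg (b : InfinitePlace L)
    (eA : Fin 3 ≃ NegIdx (cmXV L dV hdV ι₁ (cmPlacesEquiv L b))) (hP0 : IsEmpty (PosIdx (cmXV L dV hdV ι₁ (cmPlacesEquiv L b))))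
    (r₀ : PosIdx (cmXW L dV dW hdW ι₁ (cmPlacesEquiv L b))) (s₀ : NegIdx (cmXW L dV dW hdW ι₁ (cmPlacesEquiv L b)))
    (hR : Subsingleton (PosIdx (cmXW L dV dW hdW ι₁ (cmPlacesEquiv L b)))) (hS : Subsingleton (NegIdx (cmXW L dV dW hdW ι₁ (cmPlacesEquiv L b))))
    (hσ : datum b = PlaceDatum.sigmaNeg eA hP0 r₀ s₀ hR hS)
    (A : Matrix.unitaryGroup (PosIdx (cmXV L dV hdV ι₁ (cmPlacesEquiv L b))) ℂ)
    (D : Matrix.unitaryGroup (NegIdx (cmXV L dV hdV ι₁ (cmPlacesEquiv L b))) ℂ)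
    (m : ∀ b : InfinitePlace L, ((printPlaces (InfinitePlace L) (kindOf L dV hdV dW hdW ι₁ datum)
      (lamOf L dV hdV dW hdW ι₁ datum) (lamOf_ne_zero L dV hdV dW hdW ι₁ datum)
      (pinnedVacs (kindOf L dV hdV dW hdW ι₁ datum) m₁ m₂)).loc b).M) :
    linSubst (star ((reindexUnitary (pairFrame (PosIdx (cmXV L dV hdV ι₁ (cmPlacesEquiv L b))) (NegIdx (cmXV L dV hdV ι₁ (cmPlacesEquiv L b)))
        (PosIdx (cmXW L dV dW hdW ι₁ (cmPlacesEquiv L b))) (NegIdx (cmXW L dV dW hdW ι₁ (cmPlacesEquiv L b))) finProdFinEquiv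
        (cmEpsV L dV hdV ι₁ (cmPlacesEquiv L b)) (cmEpsW L dV dW hdW ι₁ (cmPlacesEquiv L b)))
        (dualPairι (((A, D), (1, 1)) : DPK (PosIdx (cmXV L dV hdV ι₁ (cmPlacesEquiv L b))) (NegIdx (cmXV L dV hdV ι₁ (cmPlacesEquiv L b)))
          (PosIdx (cmXW L dV dW hdW ι₁ (cmPlacesEquiv L b))) (NegIdx (cmXW L dV dW hdW ι₁ (cmPlacesEquiv L b))))) :
          Matrix.unitaryGroup (Fin 6) ℂ) : Matrix (Fin 6) (Fin 6) ℂ))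
        (placePoly L dV hdV dW hdW ι₁ datum m₁ m₂ m (cmPlacesEquiv L b)) =
      placePoly L dV hdV dW hdW ι₁ datum m₁ m₂ m (cmPlacesEquiv L b) := by
  rw [placePoly_apply]
  refine linSubst_emb_of_eq_sigmaNeg L dV hdV dW hdW ι₁ _ eA hP0 r₀ s₀ hR hS _ (fun k => ?_) (datum b) hσ _ (m b)
  have hidx : ((PlaceDatum.sigmaNeg eA hP0 r₀ s₀ hR hS : PlaceDatum L dV hdV dW hdW ι₁ (cmPlacesEquiv L b)).idx :
      HodgeCM.PerL34.Fock.MixedVar → Fin 6) =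
      (pairFrame (PosIdx (cmXV L dV hdV ι₁ (cmPlacesEquiv L b))) (NegIdx (cmXV L dV hdV ι₁ (cmPlacesEquiv L b)))
        (PosIdx (cmXW L dV dW hdW ι₁ (cmPlacesEquiv L b))) (NegIdx (cmXW L dV dW hdW ι₁ (cmPlacesEquiv L b))) finProdFinEquiv
        (cmEpsV L dV hdV ι₁ (cmPlacesEquiv L b)) (cmEpsW L dV dW hdW ι₁ (cmPlacesEquiv L b))).symm ∘
        mixedToDPIdxNeg (PosIdx (cmXV L dV hdV ι₁ (cmPlacesEquiv L b))) eA r₀ s₀ := by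
    funext x
    change (cmIdx L dV hdV dW hdW ι₁ (cmPlacesEquiv L b)).symm (mixedToDPIdxNeg _ eA r₀ s₀ x) = _
    rw [cmIdx_eq_pairFrame]
    rfl
  have hre : rename ((PlaceDatum.sigmaNeg eA hP0 r₀ s₀ hR hS : PlaceDatum L dV hdV dW hdW ι₁ (cmPlacesEquiv L b)).idx)
        (HodgeCM.PerL34.Fock.P ^ k) =
      rename (pairFrame (PosIdx (cmXV L dV hdV ι₁ (cmPlacesEquiv L b))) (NegIdx (cmXV L dV hdV ι₁ (cmPlacesEquiv L b)))
        (PosIdx (cmXW L dV dW hdW ι₁ (cmPlacesEquiv L b))) (NegIdx (cmXW L dV dW hdW ι₁ (cmPlacesEquiv L b))) finProdFinEquiv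
        (cmEpsV L dV hdV ι₁ (cmPlacesEquiv L b)) (cmEpsW L dV dW hdW ι₁ (cmPlacesEquiv L b))).symm
        (rename (mixedToDPIdxNeg (PosIdx (cmXV L dV hdV ι₁ (cmPlacesEquiv L b))) eA r₀ s₀) (HodgeCM.PerL34.Fock.P ^ k)) := by
    rw [rename_rename]
    exact congrArg (fun j => rename j (HodgeCM.PerL34.Fock.P ^ k)) hidx
  rw [hre, linSubst_star_reindexUnitary_rename, linSubst_star_dualPairι_kV_rename_P_pow_neg]

end Datum

end HodgeCM.Model.HypCensus

end
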